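import Mathlib
import Summits.CriticalPhenomena.CardyFormulaZ2.Theorems.CardySelfRefinementDefs
import Summits.CriticalPhenomena.CardyFormulaZ2.Theorems.CardySelfRefinementGradientComparabilityStubCornerHWBRhoLeg
import HarnessLib

/-!
# Crux `GradientComparability` (stmt-CriticalPhenomena-10269), line `monotone-product-coordinates` —
# stub `stub_cornerHardWayBoxes` (HWB), brick (iii′): integration along the Aizenman–Grimmett segment

Route `CardySelfRefinement`; vocabulary from `CardySelfRefinementDefs` (`ax tb opn cfg prm M`); the
bundle surgery, the per-bundle domination `q_σ |Infl σ| ≤ Infl sh` and the one-layer Russo formulas of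
the three-parameter family `M_k(ρ, c; p)` (own coins fair on axial edges and `c` on interior edges,
shared coins `p`, selectors `ρ`, pushed forward by `cfg k`) from `…StubCornerHWBRhoLeg`.

## Mathematics

For an increasing cylinder event `X` put `F(ρ, p, c) = M_k(ρ, c; p)(X)`, a polynomial in the clamped
parameters.  The revised route to (HWB) (report `hwb_report.md` §2) combines
* (i) `hardWayBoxes_one_of_half_lt` (landed): hard-way boxes have `F(1, p, c) ≥ 1 - ε` for `p > 1/2`;
* (ii-ρ) `|∂ρF| ≤ 2 ∂pF` for `ρ ≥ 1/2` (landed, `…StubCornerHWBRhoLeg`);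
* (ii-c) the Aizenman–Grimmett interior-bypass inequality `∂pF ≤ L ∂cF` on
  `[1/2, 1] × [1/2, 3/4] × [c₀/2, c₀]` (the remaining hard brick; a HYPOTHESIS here);
* (iii′) THIS FILE (`hardWayBoxes_segment_integration`, REGISTERED): with `δ = c₀ / (10 L)`, along
  `t ↦ (1 + (ρ - 1) t, 1/2 + δ - δ t, c₀/2 + (c₀/2) t)`, `t ∈ [0,1]`, `ρ ∈ [1 - 2δ, 1]`, Russo's formula
  along the path (`hasDerivWithinAt_real_bundles`: `stub_russoWithin_signed` grouped by bundles) gives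
  the speed `Σ_bundles ((¬axial ? c₀/2 : 0)·Infl own − δ·Infl sh + (ρ − 1)·Infl sel)`, which is
  `≥ (c₀/2) Σ_int − 5δ Σ_sh ≥ (c₀/2)(Σ_int − Σ_sh / L) ≥ 0` by (ii-ρ) per bundle
  (`|Infl sel| ≤ 2 Infl sh`, `1 - ρ_t ≤ 2δ`) and (ii-c) (`Σ_sh ≤ L Σ_int`, the two one-layer Russo
  identities `hasDerivWithinAt_real_shared` / `hasDerivWithinAt_real_interior` turning `∂pF`, `∂cF`
  into influence sums); so `t ↦ F(path)` is monotone (`monotoneOn_of_hasDerivWithinAt_nonneg`) and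
  `F(1, 1/2 + δ, c₀/2) ≤ F(ρ, 1/2, c₀) = M_k(ρ, c₀)(X)`.
Hence (HWB) = (i) + (ii-c) + (iii′): `δ` is independent of `ε`, `n`, `w`.
(Aizenman–Grimmett, J. Stat. Phys. 63 (1991), essential enhancements; Grimmett 1999 §3.3; Russo 1981.)
-/

noncomputable section

namespace Summit.CriticalPhenomena.CardyFormulaZ2.Theorems.CardySelfRefinement

open scoped Topology
open Filter Set MeasureTheory
open Literature.Probability.LatticeModels Literature.Probability.Percolation
open Literature.Probability.Percolation.QuadCrossing
open Summit.CriticalPhenomena.CardyFormulaZ2.Theses.CardySelfRefinement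

/-- The three-parameter coin law of `M_k(ρ, c; p)` (local notation, as in `…StubCornerHWBRhoLeg`;
written inline in the registered statement). -/
local notation3 (prettyPrint := false) "prm₃(" k ", " ρ ", " p ", " c ")" =>
  (fun i : Site 2 × Fin 2 × Fin 3 =>
    if i.2.2 = 0 then (if ax k (i.1, i.2.1) then half else Set.projIcc (0 : ℝ) 1 zero_le_one c)
    else if i.2.2 = 1 then Set.projIcc (0 : ℝ) 1 zero_le_one p
    else Set.projIcc (0 : ℝ) 1 zero_le_one ρ : Site 2 × Fin 2 × Fin 3 → unitInterval)

/-! ## Russo along a path of coin biases, bundle form -/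

/-- **Russo along a path, bundle form.**  If along `b ↦ q b` the own / shared / selector coin of
every bundle `(t, d)` moves with speed `q₀ (t,d)` / `q₁ (t,d)` / `q₂ (t,d)` (within `s` at `β`) and
`E` is determined by the coins of the finite bundle set `T`, then `b ↦ P_{q b}(E)` has derivative
`Σ_{(t,d) ∈ T} (q₀ Infl (t,d,0) + q₁ Infl (t,d,1) + q₂ Infl (t,d,2))` within `s` at `β`
(`stub_russoWithin_signed`, reindexed by bundles and layers). -/
theorem hasDerivWithinAt_real_bundles {q : ℝ → Site 2 × Fin 2 × Fin 3 → unitInterval} {s : Set ℝ}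
    {β : ℝ} (q₀ q₁ q₂ : Site 2 × Fin 2 → ℝ)
    (h0 : ∀ td : Site 2 × Fin 2, HasDerivWithinAt (fun b => (q b (td.1, td.2, 0) : ℝ)) (q₀ td) s β)
    (h1 : ∀ td : Site 2 × Fin 2, HasDerivWithinAt (fun b => (q b (td.1, td.2, 1) : ℝ)) (q₁ td) s β)
    (h2 : ∀ td : Site 2 × Fin 2, HasDerivWithinAt (fun b => (q b (td.1, td.2, 2) : ℝ)) (q₂ td) s β)
    {E : Set (Set (Site 2 × Fin 2 × Fin 3))} (T : Finset (Site 2 × Fin 2))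
    (hE : DeterminedBy E ↑((T ×ˢ (Finset.univ : Finset (Fin 3))).map
      (Equiv.prodAssoc (Site 2) (Fin 2) (Fin 3)).toEmbedding)) :
    HasDerivWithinAt (fun b => (prodBernoulli (q b)).real E)
      (∑ td ∈ T, (q₀ td * ((prodBernoulli (q β)).real {S | insert (td.1, td.2, (0 : Fin 3)) S ∈ E} -
          (prodBernoulli (q β)).real {S | S \ {(td.1, td.2, (0 : Fin 3))} ∈ E}) +
        q₁ td * ((prodBernoulli (q β)).real {S | insert (td.1, td.2, (1 : Fin 3)) S ∈ E} -
          (prodBernoulli (q β)).real {S | S \ {(td.1, td.2, (1 : Fin 3))} ∈ E}) +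
        q₂ td * ((prodBernoulli (q β)).real {S | insert (td.1, td.2, (2 : Fin 3)) S ∈ E} -
          (prodBernoulli (q β)).real {S | S \ {(td.1, td.2, (2 : Fin 3))} ∈ E}))) s β := by
  classical
  set p' : Site 2 × Fin 2 × Fin 3 → ℝ := fun i =>
    if i.2.2 = 0 then q₀ (i.1, i.2.1) else if i.2.2 = 1 then q₁ (i.1, i.2.1) else q₂ (i.1, i.2.1) with hp'
  have hp : ∀ i ∈ (T ×ˢ (Finset.univ : Finset (Fin 3))).map
      (Equiv.prodAssoc (Site 2) (Fin 2) (Fin 3)).toEmbedding,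
      HasDerivWithinAt (fun b => (q b i : ℝ)) (p' i) s β := by
    rintro ⟨x, e, j⟩ -
    fin_cases j
    · simpa [hp'] using h0 (x, e)
    · simpa [hp'] using h1 (x, e)
    · simpa [hp'] using h2 (x, e)
  convert stub_russoWithin_signed q E hE s β p' hp using 1
  rw [Finset.sum_map, Finset.sum_product]
  refine Finset.sum_congr rfl fun td _ => ?_
  rw [Fin.sum_univ_three]
  simp [hp']

/-- Russo for the three-parameter family in the interior bias `c ∈ [0,1]` (within `[0,1]`): only
the own coins of the NON-axial edges move, `∂c P(E) = Σ_{(t,d) ∈ T, ¬ axial} Infl (t, d, 0)`. -/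
theorem hasDerivWithinAt_real_interior (k : ℕ) (ρ p : ℝ) {c : ℝ} (hc : c ∈ Set.Icc (0 : ℝ) 1)
    {E : Set (Set (Site 2 × Fin 2 × Fin 3))} (T : Finset (Site 2 × Fin 2))
    (hE : DeterminedBy E ↑((T ×ˢ (Finset.univ : Finset (Fin 3))).map
      (Equiv.prodAssoc (Site 2) (Fin 2) (Fin 3)).toEmbedding)) :
    HasDerivWithinAt (fun b => (prodBernoulli prm₃(k, ρ, p, b)).real E)
      (∑ td ∈ T, (if ax k td then (0 : ℝ) else 1) *
        ((prodBernoulli prm₃(k, ρ, p, c)).real {S | insert (td.1, td.2, (0 : Fin 3)) S ∈ E} -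
          (prodBernoulli prm₃(k, ρ, p, c)).real {S | S \ {(td.1, td.2, (0 : Fin 3))} ∈ E}))
      (Set.Icc 0 1) c := by
  have h := hasDerivWithinAt_real_bundles (q := fun b => prm₃(k, ρ, p, b)) (s := Set.Icc 0 1) (β := c)
    (fun td => if ax k td then (0 : ℝ) else 1) (fun _ => 0) (fun _ => 0) (fun td => ?_) (fun td => ?_)
    (fun td => ?_) T hE
  · convert h using 1
    refine Finset.sum_congr rfl fun td _ => ?_
    ring
  · obtain ⟨x, e⟩ := td
    by_cases hax : ax k (x, e)
    · simpa [hax] using hasDerivWithinAt_const c (Set.Icc (0 : ℝ) 1) ((half : unitInterval) : ℝ)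
    · simpa [hax] using (hasDerivWithinAt_id c _).congr_of_mem
        (f₁ := fun b : ℝ => ((Set.projIcc (0 : ℝ) 1 zero_le_one b : unitInterval) : ℝ))
        (fun b hb => by simp [Set.projIcc_of_mem _ hb]) hc
  · simpa using hasDerivWithinAt_const c (Set.Icc (0 : ℝ) 1)
      ((Set.projIcc (0 : ℝ) 1 zero_le_one p : unitInterval) : ℝ)
  · simpa using hasDerivWithinAt_const c (Set.Icc (0 : ℝ) 1)
      ((Set.projIcc (0 : ℝ) 1 zero_le_one ρ : unitInterval) : ℝ)

/-! ## Integration along the Aizenman–Grimmett segment -/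

/-- Derivative within `[0,1]` of a clamped affine bias whose values on `[0,1]` stay in `[0,1]`. -/
theorem hasDerivWithinAt_projIcc_affine {a m t : ℝ}
    (h : ∀ b ∈ Set.Icc (0 : ℝ) 1, a + m * b ∈ Set.Icc (0 : ℝ) 1) (ht : t ∈ Set.Icc (0 : ℝ) 1) :
    HasDerivWithinAt (fun b => ((Set.projIcc (0 : ℝ) 1 zero_le_one (a + m * b) : unitInterval) : ℝ))
      m (Set.Icc 0 1) t := by
  have h1 : HasDerivWithinAt (fun b : ℝ => a + m * b) m (Set.Icc 0 1) t := by
    simpa using (((hasDerivAt_id t).const_mul m).const_add a).hasDerivWithinAt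
  exact h1.congr_of_mem (fun b hb => by rw [Set.projIcc_of_mem _ (h b hb)]) ht

/-- **The speed inequality along the segment** (elementary): with `5 δ L = c₀/2`, `1 - ρ ≤ 2δ`,
`ρ ≤ 1`, nonnegative shared influences `I₁`, selector influences `|I₂| ≤ 2 I₁` and the
interior-bypass inequality `Σ I₁ ≤ L Σ_{¬P} I₀`, the speed
`Σ ((¬P ? c₀/2 : 0) I₀ − δ I₁ + (ρ − 1) I₂)` is nonnegative. -/
theorem segment_speed_sum_nonneg {ι : Type*} (T : Finset ι) (P : ι → Prop) [DecidablePred P]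
    (I₀ I₁ I₂ : ι → ℝ) {c₀ L ρ δ : ℝ} (hδ : 0 ≤ δ) (hδL : 5 * δ * L = c₀ / 2)
    (hρ : 1 - ρ ≤ 2 * δ) (hρ1 : ρ ≤ 1) (hI₁ : ∀ i ∈ T, 0 ≤ I₁ i) (hI₂ : ∀ i ∈ T, |I₂ i| ≤ 2 * I₁ i)
    (hK : ∑ i ∈ T, I₁ i ≤ L * ∑ i ∈ T, (if P i then (0 : ℝ) else 1) * I₀ i) :
    0 ≤ ∑ i ∈ T, ((if P i then (0 : ℝ) else c₀ / 2) * I₀ i + -δ * I₁ i + (ρ - 1) * I₂ i) := by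
  have hstep : ∀ i ∈ T, c₀ / 2 * ((if P i then (0 : ℝ) else 1) * I₀ i) - 5 * δ * I₁ i ≤
      (if P i then (0 : ℝ) else c₀ / 2) * I₀ i + -δ * I₁ i + (ρ - 1) * I₂ i := by
    intro i hi
    have h2 : I₂ i ≤ 2 * I₁ i := (le_abs_self _).trans (hI₂ i hi)
    have P1 : 0 ≤ (1 - ρ) * (2 * I₁ i - I₂ i) := mul_nonneg (by linarith) (by linarith)
    have P2 : 0 ≤ (2 * δ - (1 - ρ)) * I₁ i := mul_nonneg (by linarith) (hI₁ i hi)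
    have e4 : c₀ / 2 * ((if P i then (0 : ℝ) else 1) * I₀ i) =
        (if P i then (0 : ℝ) else c₀ / 2) * I₀ i := by
      split_ifs <;> ring
    nlinarith [P1, P2, e4]
  have hmul : δ * ∑ i ∈ T, I₁ i ≤ δ * (L * ∑ i ∈ T, (if P i then (0 : ℝ) else 1) * I₀ i) :=
    mul_le_mul_of_nonneg_left hK hδ
  have e : 5 * (δ * (L * ∑ i ∈ T, (if P i then (0 : ℝ) else 1) * I₀ i)) =
      c₀ / 2 * ∑ i ∈ T, (if P i then (0 : ℝ) else 1) * I₀ i := by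
    rw [← hδL]; ring
  calc (0 : ℝ) ≤ c₀ / 2 * (∑ i ∈ T, (if P i then (0 : ℝ) else 1) * I₀ i) - 5 * δ * ∑ i ∈ T, I₁ i := by
        nlinarith [hmul, e]
    _ = ∑ i ∈ T, (c₀ / 2 * ((if P i then (0 : ℝ) else 1) * I₀ i) - 5 * δ * I₁ i) := by
        rw [Finset.sum_sub_distrib, Finset.mul_sum, Finset.mul_sum]
    _ ≤ _ := Finset.sum_le_sum hstep

/-- **Brick (iii′) of stub `stub_cornerHardWayBoxes` (HWB): integration along the
Aizenman–Grimmett segment.**  Let `X` be an increasing measurable event whose pull-back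
`cfg k ⁻¹' X` is determined by finitely many coins, `0 < c₀ ≤ 1`, `L ≥ 1`, and assume the
interior-bypass inequality (ii-c) `∂p F ≤ L ∂c F` for the three-parameter family
`F(ρ, p, c) = M_k(ρ, c; p)(X)` on `ρ ∈ [1/2, 1]`, `p ∈ [1/2, 3/4]`, `c ∈ [c₀/2, c₀]` (one-sided
derivatives within `[0,1]`).  Then for every `ρ ∈ [1 - 2δ, 1]`, `δ = c₀/(10L)`:
`F(1, 1/2 + c₀/(10L), c₀/2) ≤ M_k(ρ, c₀)(X)` — along the segment from `(1, 1/2 + δ, c₀/2)` to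
`(ρ, 1/2, c₀)`, `δ = c₀/(10L)`, the speed `-(1-ρ) ∂ρF - δ ∂pF + (c₀/2) ∂cF` is `≥ 0` by (ii-ρ)
(`selector_infl_abs_le_shared_infl`) and (ii-c) (Russo along the path, `hasDerivWithinAt_real_bundles`). -/
theorem hardWayBoxes_segment_integration : ∀ k : ℕ, ∀ X : Set (BondConfig (Site 2)), IsUpperSet X → MeasurableSet X → ∀ K : Finset (Site 2 × Fin 2 × Fin 3), DeterminedBy ((cfg k) ⁻¹' X) (↑K : Set (Site 2 × Fin 2 × Fin 3)) → ∀ c₀ : ℝ, 0 < c₀ → c₀ ≤ 1 → ∀ L : ℝ, 1 ≤ L → (∀ ρ ∈ Set.Icc (1 / 2 : ℝ) 1, ∀ p ∈ Set.Icc (1 / 2 : ℝ) (3 / 4), ∀ c ∈ Set.Icc (c₀ / 2) c₀, derivWithin (fun p' => ((prodBernoulli (fun i : Site 2 × Fin 2 × Fin 3 => if i.2.2 = 0 then (if ax k (i.1, i.2.1) then half else Set.projIcc (0 : ℝ) 1 zero_le_one c) else if i.2.2 = 1 then Set.projIcc (0 : ℝ) 1 zero_le_one p' else Set.projIcc (0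 : ℝ) 1 zero_le_one ρ)).map (cfg k)).real X) (Set.Icc 0 1) p ≤ L * derivWithin (fun c' => ((prodBernoulli (fun i : Site 2 × Fin 2 × Fin 3 => if i.2.2 = 0 then (if ax k (i.1, i.2.1) then half else Set.projIcc (0 : ℝ) 1 zero_le_one c') else if i.2.2 = 1 then Set.projIcc (0 : ℝ) 1 zero_le_one p else Set.projIcc (0 : ℝ) 1 zero_le_one ρ)).map (cfg k)).real X) (Set.Icc 0 1) c) → ∀ ρ ∈ Set.Icc (1 - 2 * (c₀ / (10 * L))) 1, ((prodBernoulli (fun i : Site 2 × Fin 2 × Fin 3 => if i.2.2 = 0 then (if ax k (i.1, i.2.1) then half else Set.projIcc (0 : ℝ) 1 zero_le_one (c₀ / 2)) else if i.2.2 = 1 then Set.projIcc (0 : ℝ) 1 zero_le_one (1 / 2 + c₀ / (10 * L)) else Set.projIcc (0 : ℝ) 1 zero_le_one 1)).map (cfg k)).real X ≤ (M k ρ c₀).real X := by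
  classical
  intro k X hX hXm K hK c₀ hc₀ hc₁ L hL HK ρ hρ
  -- coins by whole bundles; the coin side
  set T : Finset (Site 2 × Fin 2) := K.image fun i => (i.1, i.2.1) with hT
  have hE : DeterminedBy ((cfg k) ⁻¹' X) ↑((T ×ˢ (Finset.univ : Finset (Fin 3))).map
      (Equiv.prodAssoc (Site 2) (Fin 2) (Fin 3)).toEmbedding) := by
    refine hK.mono fun i hi => Finset.mem_coe.2 (Finset.mem_map.2 ⟨((i.1, i.2.1), i.2.2),
      Finset.mem_product.2 ⟨Finset.mem_image_of_mem _ (Finset.mem_coe.1 hi), Finset.mem_univ _⟩,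
      rfl⟩)
  have hF : ∀ ρ₁ p₁ c₁ : ℝ, ((prodBernoulli prm₃(k, ρ₁, p₁, c₁)).map (cfg k)).real X =
      (prodBernoulli prm₃(k, ρ₁, p₁, c₁)).real ((cfg k) ⁻¹' X) := fun _ _ _ =>
    map_measureReal_apply (measurable_cfg k) hXm
  -- the constants
  set δ : ℝ := c₀ / (10 * L) with hδ
  have hL0 : 0 < L := by linarith
  have hδ0 : 0 < δ := by positivity
  have hδ1 : δ ≤ 1 / 10 := by
    rw [hδ, div_le_iff₀ (by positivity)]
    nlinarith
  have hδL : 5 * δ * L = c₀ / 2 := by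
    rw [hδ]
    field_simp
    ring
  have hρδ : 1 - ρ ≤ 2 * δ := by linarith [hρ.1]
  have hρI : ∀ b ∈ Set.Icc (0 : ℝ) 1, 1 + (ρ - 1) * b ∈ Set.Icc (0 : ℝ) 1 := fun b hb =>
    ⟨by nlinarith [hb.1, hb.2, hρ.2], by nlinarith [hb.1, hb.2, hρ.2]⟩
  have hpI : ∀ b ∈ Set.Icc (0 : ℝ) 1, 1 / 2 + δ + -δ * b ∈ Set.Icc (0 : ℝ) 1 := fun b hb =>
    ⟨by nlinarith [hb.1, hb.2], by nlinarith [hb.1, hb.2]⟩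
  have hcI : ∀ b ∈ Set.Icc (0 : ℝ) 1, c₀ / 2 + c₀ / 2 * b ∈ Set.Icc (0 : ℝ) 1 := fun b hb =>
    ⟨by nlinarith [hb.1, hb.2], by nlinarith [hb.1, hb.2]⟩
  -- the path `b ↦ F(1 + (ρ-1) b, 1/2 + δ - δ b, c₀/2 + (c₀/2) b)` on the coin side
  set G : ℝ → ℝ := fun b => (prodBernoulli prm₃(k, 1 + (ρ - 1) * b, 1 / 2 + δ + -δ * b,
    c₀ / 2 + c₀ / 2 * b)).real ((cfg k) ⁻¹' X) with hG
  -- its speed is nonnegative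
  have key : ∀ t ∈ Set.Icc (0 : ℝ) 1, ∃ D : ℝ, HasDerivWithinAt G D (Set.Icc 0 1) t ∧ 0 ≤ D := by
    intro t ht
    have hρt : 1 + (ρ - 1) * t ∈ Set.Icc (1 / 2 : ℝ) 1 :=
      ⟨by nlinarith [ht.1, ht.2, hρ.2], by nlinarith [ht.1, ht.2, hρ.2]⟩
    have hρt' : 1 + (ρ - 1) * t ∈ Set.Icc (0 : ℝ) 1 := hρI t ht
    have hpt : 1 / 2 + δ + -δ * t ∈ Set.Icc (1 / 2 : ℝ) (3 / 4) :=
      ⟨by nlinarith [ht.1, ht.2], by nlinarith [ht.1, ht.2]⟩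
    have hpt' : 1 / 2 + δ + -δ * t ∈ Set.Icc (0 : ℝ) 1 := hpI t ht
    have hct : c₀ / 2 + c₀ / 2 * t ∈ Set.Icc (c₀ / 2) c₀ :=
      ⟨by nlinarith [ht.1, ht.2], by nlinarith [ht.1, ht.2]⟩
    have hct' : c₀ / 2 + c₀ / 2 * t ∈ Set.Icc (0 : ℝ) 1 := hcI t ht
    -- Russo along the path
    have h := hasDerivWithinAt_real_bundles
      (q := fun b => prm₃(k, 1 + (ρ - 1) * b, 1 / 2 + δ + -δ * b, c₀ / 2 + c₀ / 2 * b))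
      (s := Set.Icc 0 1) (β := t) (fun td => if ax k td then (0 : ℝ) else c₀ / 2) (fun _ => -δ)
      (fun _ => ρ - 1) (fun td => ?_) (fun td => ?_) (fun td => ?_) T hE
    rotate_left
    · obtain ⟨x, e⟩ := td
      by_cases hax : ax k (x, e)
      · simpa [hax] using hasDerivWithinAt_const t (Set.Icc (0 : ℝ) 1) ((half : unitInterval) : ℝ)
      · simpa [hax] using hasDerivWithinAt_projIcc_affine hcI ht
    · simpa using hasDerivWithinAt_projIcc_affine hpI ht
    · simpa using hasDerivWithinAt_projIcc_affine hρI ht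
    beta_reduce at h
    -- (ii-c) at the path point, on the coin side
    have HK' := HK _ hρt _ hpt _ hct
    simp only [hF] at HK'
    rw [(hasDerivWithinAt_real_shared k _ _ hpt' T hE).derivWithin (uniqueDiffOn_Icc zero_lt_one _ hpt'),
      (hasDerivWithinAt_real_interior k _ _ hct' T hE).derivWithin
        (uniqueDiffOn_Icc zero_lt_one _ hct')] at HK'
    set μ := prodBernoulli prm₃(k, 1 + (ρ - 1) * t, 1 / 2 + δ + -δ * t, c₀ / 2 + c₀ / 2 * t) with hμ
    -- (ii-ρ) at the path point, per bundle
    have hI₁ : ∀ td ∈ T, 0 ≤ μ.real {S | insert (td.1, td.2, (1 : Fin 3)) S ∈ (cfg k) ⁻¹' X} -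
        μ.real {S | S \ {(td.1, td.2, (1 : Fin 3))} ∈ (cfg k) ⁻¹' X} := fun td _ =>
      shared_infl_nonneg k td.1 td.2 hX hXm _
    have hI₂ : ∀ td ∈ T, |μ.real {S | insert (td.1, td.2, (2 : Fin 3)) S ∈ (cfg k) ⁻¹' X} -
        μ.real {S | S \ {(td.1, td.2, (2 : Fin 3))} ∈ (cfg k) ⁻¹' X}| ≤
        2 * (μ.real {S | insert (td.1, td.2, (1 : Fin 3)) S ∈ (cfg k) ⁻¹' X} -
          μ.real {S | S \ {(td.1, td.2, (1 : Fin 3))} ∈ (cfg k) ⁻¹' X}) := by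
      intro td _
      refine abs_le_two_mul_of_half_le ?_ (selector_infl_abs_le_shared_infl k td.1 td.2 hX hXm _)
      simpa [Set.projIcc_of_mem _ hρt'] using hρt.1
    exact ⟨_, h, segment_speed_sum_nonneg T (ax k) _ _ _ hδ0.le hδL hρδ hρ.2 hI₁ hI₂ HK'⟩
  -- hence the path is monotone
  have hmono : MonotoneOn G (Set.Icc 0 1) := by
    refine monotoneOn_of_hasDerivWithinAt_nonneg (convex_Icc 0 1)
      (fun t ht => (key t ht).choose_spec.1.continuousWithinAt)
      (f' := fun t => if h : t ∈ Set.Icc (0 : ℝ) 1 then (key t h).choose else 0)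
      (fun t ht => ?_) (fun t ht => ?_)
    · have ht' : t ∈ Set.Icc (0 : ℝ) 1 := interior_subset ht
      simp only [dif_pos ht']
      exact (key t ht').choose_spec.1.mono interior_subset
    · have ht' : t ∈ Set.Icc (0 : ℝ) 1 := interior_subset ht
      simp only [dif_pos ht']
      exact (key t ht').choose_spec.2
  have h01 := hmono (Set.left_mem_Icc.2 zero_le_one) (Set.right_mem_Icc.2 zero_le_one) zero_le_one
  -- the endpoints
  have e1 : (1 : ℝ) + (ρ - 1) * 1 = ρ := by ring
  have e2 : (1 : ℝ) / 2 + δ + -δ * 1 = 1 / 2 := by ring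
  have e3 : c₀ / 2 + c₀ / 2 * 1 = c₀ := by ring
  have e4 : (1 : ℝ) + (ρ - 1) * 0 = 1 := by ring
  have e5 : (1 : ℝ) / 2 + δ + -δ * 0 = 1 / 2 + δ := by ring
  have e6 : c₀ / 2 + c₀ / 2 * 0 = c₀ / 2 := by ring
  have hprm : prm₃(k, ρ, 1 / 2, c₀) = prm k ρ c₀ := by
    funext i
    simp only [prm, projIcc_unitInterval_half]
  have hG1 : G 1 = (M k ρ c₀).real X := by
    rw [show M k ρ c₀ = (prodBernoulli (prm k ρ c₀)).map (cfg k) from rfl,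
      map_measureReal_apply (measurable_cfg k) hXm, ← hprm]
    simp only [hG, e1, e2, e3]
  have hG0 : G 0 = (prodBernoulli prm₃(k, 1, 1 / 2 + δ, c₀ / 2)).real ((cfg k) ⁻¹' X) := by
    simp only [hG, e4, e5, e6]
  rw [hF, ← hG0, ← hG1]
  exact h01

end Summit.CriticalPhenomena.CardyFormulaZ2.Theorems.CardySelfRefinement

end
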